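import Literature.AlgebraicGeometry.Modules.IsoOfFrames
import HarnessLib

/-!
# Modules with frames on a common cover related by compatible invertible matrices are isomorphic

Topic: `Literature/AlgebraicGeometry/Modules`. Let `M`, `N` be `𝒪_X`-modules on a scheme `X`,
`(W_a)_{a ∈ ι}` a family of opens with `⨆ W_a = ⊤`, and frames `e_a : 𝒪^{J_a} ≅ M|_{W_a}`,
`f_a : 𝒪^{J'_a} ≅ N|_{W_a}` (Mathlib `SheafOfModules.free _ ≅ _.over _`). Suppose given matrices of
sections `G_a ∈ Mat_{J'_a × J_a}(Γ(X, W_a))`, `G'_a ∈ Mat_{J_a × J'_a}(Γ(X, W_a))` with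
`G'_a G_a = 1`, `G_a G'_a = 1`, which are COMPATIBLE with the transition matrices
(`Modules/FrameTransition`) on the overlaps: `T(f_a, f_b) · G_b = G_a · T(e_a, e_b)` over `W_a ∩ W_b`
(the companion identity `T(e_a, e_b) · G'_b = G'_a · T(f_a, f_b)` follows, `transition_mul_map_inv_eq`). Then the local morphisms `M|_{W_a} → N|_{W_a}`, `b^e_{a,l} ↦ ∑_i (G_a)_{il} b^f_{a,i}`
(`homOfBasisValues`, `Modules/SheafHomExact`) agree on overlaps, glue
(`Modules/SheafHom.glueHom`), and the glued morphism is an isomorphism with inverse glued from the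
`G'_a` (Hartshorne II Ex. 5.18 (b)/(c): morphisms / isomorphisms of locally free sheaves in terms of
transition data; The Stacks Project, Tag 00AK). The case `G_a = G'_a = 1` is `Modules/IsoOfFrames`.

* `appLE_homOfBasisValues_map` — values of `homOfBasisValues` on restricted basis sections;
* `homOfBasisValues_matrix_comp` — `(b ↦ G b) ≫ (b ↦ G' b) = 𝟙` when `G' G = 1`;
* `restrictHom_homOfBasisValues_matrix_eq` — compatibility on overlaps from the matrix identity;
* `exists_hom_over_iSup_of_framesMatrix` — a morphism `M|_{⨆ W_a} ⟶ N|_{⨆ W_a}` restricting to the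
  local matrix morphisms; `glue_comp_glue_eq_id` — two such gluings compose to `𝟙` when `G' G = 1`;
* `nonempty_iso_of_framesMatrix` — **`M ≅ N`**.

THEOREMS ONLY (the constructions stay inside the proofs); everything is proved, no named facts.
This is the gluing step of the descent of ISOMORPHISMS of finite locally free modules along a limit
of schemes (`Limits/FiniteLocallyFreeIsoDescent`, The Stacks Project Tag 0B8W (2)).

## References

* R. Hartshorne, *Algebraic Geometry*, GTM 52 (1977), II Ex. 5.18. [Hartshorne1977]
* The Stacks Project, Tag 00AK (glueing of sheaves), Tag 0B8W. [StacksProject]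
-/

noncomputable section

open CategoryTheory AlgebraicGeometry Opposite TopologicalSpace Limits

namespace Literature.AlgebraicGeometry.Modules

open Literature.AlgebraicGeometry.Motives

universe u

variable {X : Scheme.{u}} {M N : X.Modules}

/-! ### The local matrix morphisms -/

section Local

variable {W V : X.Opens} {J J' : Type u} [Fintype J] [Fintype J']
  (e : SheafOfModules.free J ≅ M.over W) (f : SheafOfModules.free J' ≅ N.over W)

omit [Fintype J] [Fintype J'] in
/-- Values of `homOfBasisValues e m` on RESTRICTED basis sections, over `V ≤ W` (a morphism of free modules is
determined by the images of the basis). [cite: Hartshorne1977, II Ex. 5.18 (a)] -/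
theorem appLE_homOfBasisValues_map (m : J → Γ(N, W)) (k : V ⟶ W) (l : J) :
    appLE (homOfBasisValues e m) k (M.presheaf.map k.op (basisSection e l)) =
      N.presheaf.map k.op (m l) := by
  rw [appLE_congr_hom (homOfBasisValues e m) k (k ≫ 𝟙 W), appLE_map, appLE_homOfBasisValues]

/-- **`(b^e_l ↦ ∑_i G_{il} b^f_i) ≫ (b^f_i ↦ ∑_l G'_{li} b^e_l) = 𝟙` when `G' G = 1`.**
[cite: Hartshorne1977, II Ex. 5.18] -/
theorem homOfBasisValues_matrix_comp [DecidableEq J] (G : Matrix J' J Γ(X, W))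
    (G' : Matrix J J' Γ(X, W)) (h : G' * G = 1) :
    homOfBasisValues e (fun l => ∑ i, G i l • basisSection f i) ≫
      homOfBasisValues f (fun i => ∑ l, G' l i • basisSection e l) = 𝟙 (M.over W) := by
  refine hom_ext_of_basisSection e fun l => ?_
  rw [appLE_comp, appLE_homOfBasisValues, appLE_id, appLE_sum_right]
  simp_rw [appLE_smul_right, appLE_homOfBasisValues, Finset.smul_sum, smul_smul]
  rw [Finset.sum_comm]
  simp_rw [← Finset.sum_smul]
  have hGG : ∀ l', (∑ i, G i l * G' l' i) = (G' * G) l' l := fun l' => by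
    rw [Matrix.mul_apply]
    exact Finset.sum_congr rfl fun i _ => mul_comm _ _
  simp_rw [hGG, h, Matrix.one_apply, ite_smul, one_smul, zero_smul]
  rw [Finset.sum_ite_eq' Finset.univ l, if_pos (Finset.mem_univ l)]

end Local

/-! ### Compatibility on overlaps and gluing -/

section Glue

variable {ι : Type u} (W : ι → X.Opens) {J J' : ι → Type u} [∀ a, Fintype (J a)]
  [∀ a, Fintype (J' a)]
  (e : ∀ a, SheafOfModules.free (J a) ≅ M.over (W a))
  (f : ∀ a, SheafOfModules.free (J' a) ≅ N.over (W a))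
  (G : ∀ a, Matrix (J' a) (J a) Γ(X, W a))

-- The local matrix morphism on `W_a` is `homOfBasisValues (e a) (fun l => ∑ i, G a i l • basisSection (f a) i)`:
-- `b^e_{a,l} ↦ ∑_i (G_a)_{il} b^f_{a,i}` (spelled out in every statement; theorems only).

/-- **Compatibility on the overlaps from the matrix identity** `T(f_a, f_b) · G_b = G_a · T(e_a, e_b)`
over `W_a ∩ W_b`. [cite: Hartshorne1977, II Ex. 5.18] -/
theorem restrictHom_homOfBasisValues_matrix_eq
    (hG : ∀ a b,
      transition (f a) (f b) (Opens.infLELeft (W a) (W b)) (Opens.infLERight (W a) (W b)) *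
          (G b).map (X.presheaf.map (Opens.infLERight (W a) (W b)).op).hom =
        (G a).map (X.presheaf.map (Opens.infLELeft (W a) (W b)).op).hom *
          transition (e a) (e b) (Opens.infLELeft (W a) (W b)) (Opens.infLERight (W a) (W b)))
    (a b : ι) :
    restrictHom (Opens.infLELeft (W a) (W b))
        (homOfBasisValues (e a) (fun l => ∑ i, G a i l • basisSection (f a) i)) =
      restrictHom (Opens.infLERight (W a) (W b))
        (homOfBasisValues (e b) (fun l => ∑ i, G b i l • basisSection (f b) i)) := by
  refine hom_ext_of_basisSection
    (SheafOfModules.restrictTrivialisation (R := X.ringCatSheaf) (Opens.infLERight (W a) (W b)) (e b))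
    fun l => ?_
  rw [basisSection_restrictTrivialisation, appLE_restrictHom, appLE_restrictHom, Category.id_comp,
    Category.id_comp]
  -- right-hand side: `ψ_b (b^e_{b,l}|) = (∑_i (G_b)_{il} b^f_{b,i})| = ∑_m (T(f_a,f_b) G_b)_{ml} b^f_{a,m}|`
  rw [appLE_homOfBasisValues_map, map_sum]
  simp_rw [Scheme.Modules.map_smul,
    map_basisSection_eq_sum_transition (f a) (f b) (Opens.infLELeft (W a) (W b))
      (Opens.infLERight (W a) (W b)), Finset.smul_sum, smul_smul]
  -- left-hand side: `ψ_a (b^e_{b,l}|) = ψ_a (∑_n T(e_a,e_b)_{nl} b^e_{a,n}|) = ∑_m (G_a T(e_a,e_b))_{ml} b^f_{a,m}|`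
  rw [map_basisSection_eq_sum_transition (e a) (e b) (Opens.infLELeft (W a) (W b))
      (Opens.infLERight (W a) (W b)) l, appLE_sum_right]
  simp_rw [appLE_smul_right, appLE_homOfBasisValues_map, map_sum, Scheme.Modules.map_smul,
    Finset.smul_sum, smul_smul]
  -- compare coefficients of `b^f_{a,m}|`
  rw [Finset.sum_comm]
  conv_rhs => rw [Finset.sum_comm]
  simp_rw [← Finset.sum_smul]
  refine Finset.sum_congr rfl fun m _ => ?_
  congr 1
  have h := congrFun (congrFun (hG a b) m) l
  rw [Matrix.mul_apply, Matrix.mul_apply] at h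
  simp only [Matrix.map_apply] at h
  -- `h : ∑ i, T(f)_{mi} * G_b(i,l)| = ∑ n, G_a(m,n)| * T(e)_{nl}`
  rw [Finset.sum_congr rfl fun n _ => mul_comm (transition (e a) (e b) _ _ n l) _, ← h]
  exact Finset.sum_congr rfl fun i _ => mul_comm _ _

variable (hG : ∀ a b,
    transition (f a) (f b) (Opens.infLELeft (W a) (W b)) (Opens.infLERight (W a) (W b)) *
        (G b).map (X.presheaf.map (Opens.infLERight (W a) (W b)).op).hom =
      (G a).map (X.presheaf.map (Opens.infLELeft (W a) (W b)).op).hom *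
        transition (e a) (e b) (Opens.infLELeft (W a) (W b)) (Opens.infLERight (W a) (W b)))

include hG in
/-- **A global morphism `M|_{⨆ W_a} → N|_{⨆ W_a}` restricting to the local matrix morphisms.**
[cite: Hartshorne1977, II Ex. 5.18] -/
theorem exists_hom_over_iSup_of_framesMatrix :
    ∃ ψ : M.over (iSup W) ⟶ N.over (iSup W),
      ∀ a, restrictHom (Opens.leSupr W a) ψ =
        homOfBasisValues (e a) (fun l => ∑ i, G a i l • basisSection (f a) i) :=
  ⟨glueHom W (fun a => homOfBasisValues (e a) (fun l => ∑ i, G a i l • basisSection (f a) i))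
      (restrictHom_homOfBasisValues_matrix_eq W e f G hG),
    restrictHom_glueHom W _ _⟩

variable [∀ a, DecidableEq (J a)] [∀ a, DecidableEq (J' a)] (G' : ∀ a, Matrix (J a) (J' a) Γ(X, W a))
  (h₁ : ∀ a, G' a * G a = 1) (h₂ : ∀ a, G a * G' a = 1)

include hG h₁ h₂ in
/-- The compatibility of the INVERSE matrices `G'_a` with the transition matrices follows from that of
the `G_a`: `T(e_a,e_b) · G'_b = G'_a · T(f_a,f_b)` over `W_a ∩ W_b` (multiply `T(f_a,f_b) G_b = G_a T(e_a,e_b)`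
by `G'_a` on the left and `G'_b` on the right). [cite: Hartshorne1977, II Ex. 5.18 (b)] -/
theorem transition_mul_map_inv_eq (a b : ι) :
    transition (e a) (e b) (Opens.infLELeft (W a) (W b)) (Opens.infLERight (W a) (W b)) *
        (G' b).map (X.presheaf.map (Opens.infLERight (W a) (W b)).op).hom =
      (G' a).map (X.presheaf.map (Opens.infLELeft (W a) (W b)).op).hom *
        transition (f a) (f b) (Opens.infLELeft (W a) (W b)) (Opens.infLERight (W a) (W b)) := by
  -- the restricted identities `G'_a G_a = 1`, `G_b G'_b = 1`
  have ha : (G' a).map (X.presheaf.map (Opens.infLELeft (W a) (W b)).op).hom *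
      (G a).map (X.presheaf.map (Opens.infLELeft (W a) (W b)).op).hom = 1 := by
    rw [← Matrix.map_mul, h₁, Matrix.map_one _ (map_zero _) (map_one _)]
  have hb : (G b).map (X.presheaf.map (Opens.infLERight (W a) (W b)).op).hom *
      (G' b).map (X.presheaf.map (Opens.infLERight (W a) (W b)).op).hom = 1 := by
    rw [← Matrix.map_mul, h₂, Matrix.map_one _ (map_zero _) (map_one _)]
  have h : (G' a).map (X.presheaf.map (Opens.infLELeft (W a) (W b)).op).hom *
      (transition (f a) (f b) (Opens.infLELeft (W a) (W b)) (Opens.infLERight (W a) (W b)) *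
        (G b).map (X.presheaf.map (Opens.infLERight (W a) (W b)).op).hom) *
      (G' b).map (X.presheaf.map (Opens.infLERight (W a) (W b)).op).hom =
    (G' a).map (X.presheaf.map (Opens.infLELeft (W a) (W b)).op).hom *
      ((G a).map (X.presheaf.map (Opens.infLELeft (W a) (W b)).op).hom *
        transition (e a) (e b) (Opens.infLELeft (W a) (W b)) (Opens.infLERight (W a) (W b))) *
      (G' b).map (X.presheaf.map (Opens.infLERight (W a) (W b)).op).hom := by
    rw [hG a b]
  set Ga := (G a).map (X.presheaf.map (Opens.infLELeft (W a) (W b)).op).hom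
  set Gb := (G b).map (X.presheaf.map (Opens.infLERight (W a) (W b)).op).hom
  set G'a := (G' a).map (X.presheaf.map (Opens.infLELeft (W a) (W b)).op).hom
  set G'b := (G' b).map (X.presheaf.map (Opens.infLERight (W a) (W b)).op).hom
  set Tf := transition (f a) (f b) (Opens.infLELeft (W a) (W b)) (Opens.infLERight (W a) (W b))
  set Te := transition (e a) (e b) (Opens.infLELeft (W a) (W b)) (Opens.infLERight (W a) (W b))
  rw [Matrix.mul_assoc G'a (Tf * Gb) G'b, Matrix.mul_assoc Tf Gb G'b, hb, Matrix.mul_one,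
    ← Matrix.mul_assoc G'a Ga Te, ha, Matrix.one_mul] at h
  exact h.symm

include h₁ in
omit [∀ a, DecidableEq (J' a)] in
/-- Two gluings whose local pieces compose to identities compose to the identity (uniqueness of glueing of
morphisms of sheaves). [cite: StacksProject, Tag 00AK (Lemma 6.33.1)] -/
theorem glue_comp_glue_eq_id
    (ψ : M.over (iSup W) ⟶ N.over (iSup W))
    (hψ : ∀ a, restrictHom (Opens.leSupr W a) ψ =
      homOfBasisValues (e a) (fun l => ∑ i, G a i l • basisSection (f a) i))
    (ψ' : N.over (iSup W) ⟶ M.over (iSup W))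
    (hψ' : ∀ a, restrictHom (Opens.leSupr W a) ψ' =
      homOfBasisValues (f a) (fun i => ∑ l, G' a l i • basisSection (e a) l)) :
    ψ ≫ ψ' = 𝟙 _ := by
  have h1 : ∀ a b, restrictHom (Opens.infLELeft (W a) (W b)) (𝟙 (M.over (W a))) =
      restrictHom (Opens.infLERight (W a) (W b)) (𝟙 (M.over (W b))) := fun a b => by
    rw [restrictHom_id, restrictHom_id]
  rw [eq_glueHom W (fun a => 𝟙 (M.over (W a))) h1 (ψ ≫ ψ') fun a => by
      rw [restrictHom_comp, hψ, hψ', homOfBasisValues_matrix_comp _ _ _ _ (h₁ a)],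
    ← eq_glueHom W (fun a => 𝟙 (M.over (W a))) h1 (𝟙 _) fun a => restrictHom_id _]

include hG h₁ h₂ in
/-- **Modules with frames on a common open cover related by compatible invertible matrices are
isomorphic** (Hartshorne II Ex. 5.18 (b)/(c); the case `G = G' = 1` is ★ `isoOfFrames`).
[cite: Hartshorne1977, II Ex. 5.18] [cite: StacksProject, Tag 00AK] -/
theorem nonempty_iso_of_framesMatrix (hW : iSup W = ⊤) : Nonempty (M ≅ N) := by
  classical
  obtain ⟨ψ, hψ⟩ := exists_hom_over_iSup_of_framesMatrix W e f G hG
  obtain ⟨ψ', hψ'⟩ := exists_hom_over_iSup_of_framesMatrix W f e G'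
    (transition_mul_map_inv_eq W e f G hG G' h₁ h₂)
  have hc : ψ ≫ ψ' = 𝟙 _ := glue_comp_glue_eq_id W e f G G' h₁ ψ hψ ψ' hψ'
  have hc' : ψ' ≫ ψ = 𝟙 _ := glue_comp_glue_eq_id W f e G' G h₂ ψ' hψ' ψ hψ
  refine ⟨{ hom := homOfTop (restrictHom (homOfLE hW.ge) ψ)
            inv := homOfTop (restrictHom (homOfLE hW.ge) ψ')
            hom_inv_id := ?_
            inv_hom_id := ?_ }⟩
  · rw [← homOfTop_comp, ← restrictHom_comp, hc, restrictHom_id, homOfTop_id]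
  · rw [← homOfTop_comp, ← restrictHom_comp, hc', restrictHom_id, homOfTop_id]

end Glue

end Literature.AlgebraicGeometry.Modules

end
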